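import Summits.AtomisticToContinuum.HydrodynamicLimit.Theorems.InformationPercolationEnginePercolationClosesChaosForecastRobustDefs
import Summits.AtomisticToContinuum.HydrodynamicLimit.Theorems.InformationPercolationEnginePercolationClosesChaosForecastNonGoodRare
import Summits.AtomisticToContinuum.HydrodynamicLimit.Theorems.InformationPercolationEnginePercolationClosesChaosForecastAlgebraMeans
import HarnessLib

/-!
# Forecast transfer W3 of the line `equilibrium-forecast-chain-rule` (crux `InformationPercolationEngine.PercolationClosesChaos`,
stmt-AtomisticToContinuum-15178) — piece H3_W of skeleton v9:
`JngSpec → CoarseLocalMaxwellianityW → LocalCountUI → NoKineticIrregularityB → NonGoodRareW`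

Support file (`--supports stmt-AtomisticToContinuum-15178`) of the registered stub `nonGoodRareW_of` (worker W3 of lead c4):
the re-typed third hypothesis `NonGoodRareW` (§R5 of `…ForecastRobustDefs`) of the weighted architecture — the
COLLISION-WEIGHTED mass `Jng (k, q) · min(ownedCount (k, q), T)` of occupied non-(binned-)good units is small in `LG`-mean —
is DISCHARGED from the dictionary fact `JngSpec` and the three LG-side regularity inputs, in the style of the v5 piece
`nonGoodRare_of` (`…ForecastNonGoodRare`), with weights:

* `nonGoodIndicatorW_le` — the pointwise split per unit, for a weight `0 ≤ m ≤ T`: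
  `𝟙{occupied ∧ ¬ GoodUnitB b} · m ≤ 𝟙{occupied ∧ ϑ < relEnt (binned)} · m + T · 𝟙{occupied ∧ Dense} +
  T · 𝟙{actual cell ∧ nbhd populated ∧ (ϑ < inhom (binned) ∨ …)}` (`GoodUnitB b … w q = GoodUnit … (binConfig b w) q`,
  binning moves no sphere: `pop_binConfig`, `nbhd_binConfig`, `dense_binConfig_iff`; an occupied cell is actual with a
  populated neighbourhood, `actual_and_nbhd_of_pop_nonempty`);
* `ngrW_measurableSet_irregularB` — the binned inhomogeneity event of `NoKineticIrregularityB` is Borel (binning is a Borel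
  map of the phase space — positions untouched, velocities through the Borel `velBin b` (`measurable_velBin`) into the countable
  discrete `Cell` and back by `binCentre b` — and moves no sphere);
* `ngrW_unitAvg_split` — on the good set (`JngSpec`) the unit averages split accordingly,
  `W ≤ F_C + T · F_D + T · F_I` (`unitAvg_mono`, `unitAvg_add'`, `unitAvg_const_mul'`; every family is box-supported because
  `ownedCount` and `pop` vanish off the box and an actual cell lies in it);
* `ngrW_unitMean_le` — the fixed-`N` assembly under any law `μ ≪ liouville` (so `μ(goodᶜ) = 0`): in the `∫⁻ ofReal` currency
  `∫⁻ ofReal W ≤ ∫⁻ ofReal F_C + ofReal T · ∫⁻ ofReal F_D + ofReal T · ∫⁻ ofReal F_I` (`lintegral_mono_ae`; `F_D`, `F_I` are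
  Borel, `F_C` — which carries the merely a.e.-measurable `ownedCount` — need not be), and back to the Bochner mean
  `unitMean = ∫ W dμ` by `ofReal_integral_eq_lintegral_ofReal` when `W ≥ 0` is integrable (else the mean is `0`);
* `nonGoodRareW_of` (the headline) — `σ₀ := min`, `c₀ := max`, `b₀ := min`, `N₀ := max` of the thresholds of
  `CoarseLocalMaxwellianityW (ϑs, ϑ, δ₃/3, T)`, `LocalCountUI` (ii) `(φs; δ₃/(3T))` and `NoKineticIrregularityB
  (ϑs, ϑ, δ₃/(3T), m₀ := 0)`.
-/

noncomputable section

open MeasureTheory Set Filter Topology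
open scoped ENNReal BigOperators Classical
open Literature.Analysis.FluidPDE Literature.MathematicalPhysics.KineticTheory
open Literature.MathematicalPhysics.KineticTheory.VelocityBlindPlacement

namespace Summit.AtomisticToContinuum.HydrodynamicLimit.Theorems.EquilibriumForecastLine

variable {σ : ℝ} {N : ℕ}

/-! ## The pointwise split of the weighted non-good indicator -/

/-- **The pointwise split of the `NonGoodRareW` summand**: for a weight `0 ≤ m ≤ T`,
(occupied ∧ not binned-good) `· m ≤` (occupied ∧ binned-non-Maxwellian) `· m + T ·` (occupied ∧ packed) `+ T ·` (actual cell with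
populated neighbourhood ∧ (binned-inhomogeneous ∨ occupied by fewer than `m₀` spheres)) — for every floor `m₀` (only the first
disjunct is used: an occupied, not packed, binned-Maxwellian, binned-homogeneous cell is binned-good, binning moving no sphere).
[folklore] -/
theorem nonGoodIndicatorW_le {c : ℝ} (hh : 0 ≤ c * meanFreePath σ N) (b ϑs ϑ φs : ℝ) {T m : ℝ} (hm0 : 0 ≤ m)
    (hmT : m ≤ T) (m₀ : ℕ) (w : Phase N) (q : Cell) :
    (if (pop c σ N w q).Nonempty ∧ ¬ GoodUnitB b ϑs ϑ φs c σ N w q then (1 : ℝ) else 0) * m ≤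
      (if (pop c σ N w q).Nonempty ∧ ϑ < relEnt ϑs (binConfig b w) (pop c σ N w q) then (1 : ℝ) else 0) * m +
        T * (if (pop c σ N w q).Nonempty ∧ Dense φs c σ N w q then (1 : ℝ) else 0) +
        T * (if (∃ x : T3, cellOf c σ N x = q) ∧ (nbhd c σ N w q).Nonempty ∧
            (ϑ < inhom ϑs (binConfig b w) (pop c σ N w q) (nbhd c σ N w q) ∨
              ((pop c σ N w q).Nonempty ∧ (pop c σ N w q).card < m₀)) then (1 : ℝ) else 0) := by
  have hT : 0 ≤ T := hm0.trans hmT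
  have h1 : 0 ≤ (if (pop c σ N w q).Nonempty ∧ ϑ < relEnt ϑs (binConfig b w) (pop c σ N w q) then (1 : ℝ) else 0) * m := by
    positivity
  have h2 : 0 ≤ T * (if (pop c σ N w q).Nonempty ∧ Dense φs c σ N w q then (1 : ℝ) else 0) := by positivity
  have h3 : 0 ≤ T * (if (∃ x : T3, cellOf c σ N x = q) ∧ (nbhd c σ N w q).Nonempty ∧
      (ϑ < inhom ϑs (binConfig b w) (pop c σ N w q) (nbhd c σ N w q) ∨
        ((pop c σ N w q).Nonempty ∧ (pop c σ N w q).card < m₀)) then (1 : ℝ) else 0) := by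
    positivity
  by_cases h : (pop c σ N w q).Nonempty ∧ ¬ GoodUnitB b ϑs ϑ φs c σ N w q
  · rw [if_pos h, one_mul]
    obtain ⟨hne, hng⟩ := h
    by_cases hD : Dense φs c σ N w q
    · have e2 : T * (if (pop c σ N w q).Nonempty ∧ Dense φs c σ N w q then (1 : ℝ) else 0) = T := by
        rw [if_pos ⟨hne, hD⟩, mul_one]
      linarith
    · by_cases hI : ϑ < inhom ϑs (binConfig b w) (pop c σ N w q) (nbhd c σ N w q)
      · have hg := actual_and_nbhd_of_pop_nonempty hh w q hne
        have e3 : T * (if (∃ x : T3, cellOf c σ N x = q) ∧ (nbhd c σ N w q).Nonempty ∧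
            (ϑ < inhom ϑs (binConfig b w) (pop c σ N w q) (nbhd c σ N w q) ∨
              ((pop c σ N w q).Nonempty ∧ (pop c σ N w q).card < m₀)) then (1 : ℝ) else 0) = T := by
          rw [if_pos ⟨hg.1, hg.2, Or.inl hI⟩, mul_one]
        linarith
      · have hE : ϑ < relEnt ϑs (binConfig b w) (pop c σ N w q) := by
          by_contra hle
          refine hng ⟨⟨?_, ?_⟩, ?_⟩
          · rwa [dense_binConfig_iff]
          · rw [pop_binConfig, nbhd_binConfig]
            exact not_lt.1 hI
          · rw [pop_binConfig]
            exact not_lt.1 hle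
        have e1 : (if (pop c σ N w q).Nonempty ∧ ϑ < relEnt ϑs (binConfig b w) (pop c σ N w q) then (1 : ℝ) else 0) * m =
            m := by
          rw [if_pos ⟨hne, hE⟩, one_mul]
        linarith
  · rw [if_neg h, zero_mul]
    linarith

/-! ## Measurability of the binned irregularity event -/

/-- The binned inhomogeneity `w ↦ inhom ϑ (binConfig b w) (pop q) (nbhd q)` is Borel: binning moves no sphere, so it is the
measurable `w ↦ inhom ϑ w (pop q) (nbhd q)` composed with `binConfig b`, which is Borel (positions untouched; each velocity goes
through the Borel `velBin b` into the countable discrete `Cell` and back by `binCentre b`). [folklore] -/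
theorem ngrW_measurable_inhomB (b ϑ c σ : ℝ) (q : Cell) :
    Measurable fun w : Phase N => inhom ϑ (binConfig b w) (pop c σ N w q) (nbhd c σ N w q) := by
  have h : (fun w : Phase N => inhom ϑ (binConfig b w) (pop c σ N w q) (nbhd c σ N w q)) =
      (fun w : Phase N => inhom ϑ w (pop c σ N w q) (nbhd c σ N w q)) ∘ binConfig b := by
    funext w
    simp only [Function.comp_apply, pop_binConfig, nbhd_binConfig]
  have hB : Measurable (binConfig (N := N) b) := by
    refine measurable_pi_lambda _ fun i => ?_
    have h1 : Measurable fun w : Phase N => w i := measurable_pi_apply i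
    exact h1.fst.prodMk ((measurable_of_countable (binCentre b)).comp ((measurable_velBin b).comp h1.snd))
  rw [h]
  exact (measurable_inhom_pop_nbhd ϑ c σ q).comp hB

/-- The unit event of `NoKineticIrregularityB` at time `t` (actual cell, populated neighbourhood, binned-inhomogeneous or
occupied by fewer than `m₀` spheres) is measurable. [folklore] -/
theorem ngrW_measurableSet_irregularB (Φ : Flow σ N) (b ϑs ϑ c t : ℝ) (m₀ : ℕ) (q : Cell) :
    MeasurableSet {z : Phase N | (∃ x : T3, cellOf c σ N x = q) ∧ (nbhd c σ N (Φ.flow t z) q).Nonempty ∧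
      (ϑ < inhom ϑs (binConfig b (Φ.flow t z)) (pop c σ N (Φ.flow t z) q) (nbhd c σ N (Φ.flow t z) q) ∨
        ((pop c σ N (Φ.flow t z) q).Nonempty ∧ (pop c σ N (Φ.flow t z) q).card < m₀))} := by
  have hn : Measurable fun w : Phase N => (nbhd c σ N w q).Nonempty :=
    measurableSet_setOf.1 (measurableSet_nbhd_nonempty c σ q)
  have hi : Measurable fun w : Phase N => ϑ < inhom ϑs (binConfig b w) (pop c σ N w q) (nbhd c σ N w q) :=
    measurableSet_setOf.1 (measurableSet_lt measurable_const (ngrW_measurable_inhomB b ϑs c σ q))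
  have hp : Measurable fun w : Phase N => (pop c σ N w q).Nonempty :=
    measurableSet_setOf.1 (measurableSet_pop_nonempty c σ q)
  have hc : Measurable fun w : Phase N => (pop c σ N w q).card < m₀ :=
    measurable_of_cellPattern c σ (g := fun π _ => (Finset.univ.filter fun i => π i = q).card < m₀)
      fun _ => measurable_const
  have hS : MeasurableSet {w : Phase N | (∃ x : T3, cellOf c σ N x = q) ∧ (nbhd c σ N w q).Nonempty ∧
      (ϑ < inhom ϑs (binConfig b w) (pop c σ N w q) (nbhd c σ N w q) ∨
        ((pop c σ N w q).Nonempty ∧ (pop c σ N w q).card < m₀))} :=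
    measurableSet_setOf.2 (measurable_const.and (hn.and (hi.or (hp.and hc))))
  exact hS.preimage (Φ.measurable_flow t)

/-! ## The split of the unit averages on the good set -/

/-- **The unit averages split on the good set**: for `z ∈ Φ.good` (where `Jng = 𝟙{occupied ∧ ¬ GoodUnitB}`, `JngSpec`),
`0 < c`, `0 < σ`, `0 ≤ T`, the unit average of `Jng · min(ownedCount, T)` is at most the unit average of
`𝟙{occupied ∧ binned-non-Maxwellian} · min(ownedCount, T)` plus `T` times the unit-fractions of occupied packed cells and of
irregular cells (floor `m₀`) — `nonGoodIndicatorW_le` unit by unit (`0 ≤ min(ownedCount, T) ≤ T`), all families being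
box-supported. [folklore] -/
theorem ngrW_unitAvg_split (hJ : JngSpec) (Φ : Flow σ N) {c : ℝ} (hc : 0 < c) (hσ : 0 < σ) (τ b ϑs ϑ φs : ℝ) {T : ℝ}
    (hT : 0 ≤ T) (m₀ : ℕ) {z : Phase N} (hz : z ∈ Φ.good) :
    (unitAvg c σ N τ fun k q => Jng b ϑs ϑ φs c σ N Φ k q z * min (ownedCount c σ N Φ k q z) T) ≤
      (unitAvg c σ N τ fun k q =>
          (if (pop c σ N (Φ.flow ((k : ℝ) * stepLen c σ N) z) q).Nonempty ∧
              ϑ < relEnt ϑs (binConfig b (Φ.flow ((k : ℝ) * stepLen c σ N) z))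
                (pop c σ N (Φ.flow ((k : ℝ) * stepLen c σ N) z) q) then (1 : ℝ) else 0) *
            min (ownedCount c σ N Φ k q z) T) +
        T * (unitAvg c σ N τ fun k q =>
          if (pop c σ N (Φ.flow ((k : ℝ) * stepLen c σ N) z) q).Nonempty ∧
              Dense φs c σ N (Φ.flow ((k : ℝ) * stepLen c σ N) z) q then (1 : ℝ) else 0) +
        T * (unitAvg c σ N τ fun k q =>
          if (∃ x : T3, cellOf c σ N x = q) ∧ (nbhd c σ N (Φ.flow ((k : ℝ) * stepLen c σ N) z) q).Nonempty ∧
              (ϑ < inhom ϑs (binConfig b (Φ.flow ((k : ℝ) * stepLen c σ N) z))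
                  (pop c σ N (Φ.flow ((k : ℝ) * stepLen c σ N) z) q) (nbhd c σ N (Φ.flow ((k : ℝ) * stepLen c σ N) z) q) ∨
                ((pop c σ N (Φ.flow ((k : ℝ) * stepLen c σ N) z) q).Nonempty ∧
                  (pop c σ N (Φ.flow ((k : ℝ) * stepLen c σ N) z) q).card < m₀)) then (1 : ℝ) else 0) := by
  have hh : 0 < c * meanFreePath σ N := mul_pos hc (meanFreePath_pos hσ N)
  -- box support of the four families (`ownedCount`, `pop` vanish off the box; an actual cell lies in it)
  have hboxW : ∀ (k : ℕ), ∀ q ∉ cellBox (c * meanFreePath σ N),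
      Jng b ϑs ϑ φs c σ N Φ k q z * min (ownedCount c σ N Φ k q z) T = 0 := fun k q hq => by
    rw [ownedCount_eq_zero_of_not_mem hh Φ k hq z, min_eq_left hT, mul_zero]
  have hboxC : ∀ (k : ℕ), ∀ q ∉ cellBox (c * meanFreePath σ N),
      (if (pop c σ N (Φ.flow ((k : ℝ) * stepLen c σ N) z) q).Nonempty ∧
          ϑ < relEnt ϑs (binConfig b (Φ.flow ((k : ℝ) * stepLen c σ N) z))
            (pop c σ N (Φ.flow ((k : ℝ) * stepLen c σ N) z) q) then (1 : ℝ) else 0) *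
        min (ownedCount c σ N Φ k q z) T = 0 := fun k q hq => by
    rw [ownedCount_eq_zero_of_not_mem hh Φ k hq z, min_eq_left hT, mul_zero]
  have hboxD : ∀ (k : ℕ), ∀ q ∉ cellBox (c * meanFreePath σ N),
      T * (if (pop c σ N (Φ.flow ((k : ℝ) * stepLen c σ N) z) q).Nonempty ∧
        Dense φs c σ N (Φ.flow ((k : ℝ) * stepLen c σ N) z) q then (1 : ℝ) else 0) = 0 := fun k q hq => by
    rw [indicator_pop_eq_zero_of_not_mem hh Φ (fun k q z => Dense φs c σ N (Φ.flow ((k : ℝ) * stepLen c σ N) z) q) z k hq,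
      mul_zero]
  have hboxI : ∀ (k : ℕ), ∀ q ∉ cellBox (c * meanFreePath σ N),
      T * (if (∃ x : T3, cellOf c σ N x = q) ∧ (nbhd c σ N (Φ.flow ((k : ℝ) * stepLen c σ N) z) q).Nonempty ∧
          (ϑ < inhom ϑs (binConfig b (Φ.flow ((k : ℝ) * stepLen c σ N) z))
              (pop c σ N (Φ.flow ((k : ℝ) * stepLen c σ N) z) q) (nbhd c σ N (Φ.flow ((k : ℝ) * stepLen c σ N) z) q) ∨
            ((pop c σ N (Φ.flow ((k : ℝ) * stepLen c σ N) z) q).Nonempty ∧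
              (pop c σ N (Φ.flow ((k : ℝ) * stepLen c σ N) z) q).card < m₀)) then (1 : ℝ) else 0) = 0 := by
    intro k q hq
    rw [if_neg, mul_zero]
    rintro ⟨⟨x, hx⟩, -⟩
    exact hq (hx ▸ cellOf_mem_cellBox hh x)
  have hboxCD : ∀ (k : ℕ), ∀ q ∉ cellBox (c * meanFreePath σ N),
      (if (pop c σ N (Φ.flow ((k : ℝ) * stepLen c σ N) z) q).Nonempty ∧
          ϑ < relEnt ϑs (binConfig b (Φ.flow ((k : ℝ) * stepLen c σ N) z))
            (pop c σ N (Φ.flow ((k : ℝ) * stepLen c σ N) z) q) then (1 : ℝ) else 0) *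
        min (ownedCount c σ N Φ k q z) T +
      T * (if (pop c σ N (Φ.flow ((k : ℝ) * stepLen c σ N) z) q).Nonempty ∧
        Dense φs c σ N (Φ.flow ((k : ℝ) * stepLen c σ N) z) q then (1 : ℝ) else 0) = 0 := fun k q hq => by
    rw [hboxC k q hq, hboxD k q hq, add_zero]
  -- pull the factors `T` in and merge the three unit averages
  rw [← unitAvg_const_mul' c σ N τ T, ← unitAvg_const_mul' c σ N τ T, ← unitAvg_add' τ hboxC hboxD,
    ← unitAvg_add' τ hboxCD hboxI]
  refine unitAvg_mono hh.le hboxW (fun k q hq => by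
    show _ + _ + _ = (0 : ℝ)
    rw [hboxC k q hq, hboxD k q hq, hboxI k q hq, add_zero, add_zero]) fun k q => ?_
  show _ ≤ _ + _ + _
  rw [hJ Φ b ϑs ϑ φs c k q z hz]
  exact nonGoodIndicatorW_le hh.le b ϑs ϑ φs (le_min (ownedCount_nonneg hc.le hσ Φ k q z) hT) (min_le_right _ _) m₀ _ q

/-! ## The fixed-`N` assembly under a law living on the good set -/

/-- **The fixed-`N` assembly of `NonGoodRareW`**: for a law `μ ≪ liouville` on the phase space (so `μ(goodᶜ) = 0`), `0 < σ`,
`0 < c`, `0 < T`, `0 ≤ δ` and a floor `m₀`, if the `∫⁻ ofReal`-means under `μ` of the unit averages of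
`𝟙{occupied ∧ binned-non-Maxwellian} · min(ownedCount, T)`, of `𝟙{occupied ∧ Dense}` and of the irregularity indicator of
`NoKineticIrregularityB` are at most `ε_C`, `ε_D`, `ε_I` with `ε_C + ofReal T · ε_D + ofReal T · ε_I ≤ ofReal δ`, then the
`μ`-mean of the unit average of `Jng · min(ownedCount, T)` is at most `δ`: `∫⁻ ofReal W ≤ ∫⁻ (ofReal F_C + ofReal T · ofReal F_D
+ ofReal T · ofReal F_I)` a.e. on the good set (`ngrW_unitAvg_split`), split by `lintegral_add_right` / `lintegral_const_mul`
along the Borel `F_D`, `F_I`, and `unitMean = ∫ W dμ ≤ δ` (`ofReal_integral_eq_lintegral_ofReal` for the nonnegative `W` when it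
is integrable, the junk value `0 ≤ δ` otherwise). [folklore] -/
theorem ngrW_unitMean_le (hJ : JngSpec) (Φ : Flow σ N) (μ : Measure (Phase N))
    (hμ : μ ≪ liouville G3 (N + 1) (hsDiameter σ N)) (hσ : 0 < σ) {c : ℝ} (hc : 0 < c) (τ b ϑs ϑ φs : ℝ) {T δ : ℝ}
    (hT : 0 < T) (hδ : 0 ≤ δ) (m₀ : ℕ) {εC εD εI : ℝ≥0∞}
    (eC : ∫⁻ z, ENNReal.ofReal (unitAvg c σ N τ fun k q =>
        (if (pop c σ N (Φ.flow ((k : ℝ) * stepLen c σ N) z) q).Nonempty ∧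
            ϑ < relEnt ϑs (binConfig b (Φ.flow ((k : ℝ) * stepLen c σ N) z))
              (pop c σ N (Φ.flow ((k : ℝ) * stepLen c σ N) z) q) then (1 : ℝ) else 0) *
          min (ownedCount c σ N Φ k q z) T) ∂μ ≤ εC)
    (eD : ∫⁻ z, ENNReal.ofReal (unitAvg c σ N τ fun k q =>
        if (pop c σ N (Φ.flow ((k : ℝ) * stepLen c σ N) z) q).Nonempty ∧
            Dense φs c σ N (Φ.flow ((k : ℝ) * stepLen c σ N) z) q then (1 : ℝ) else 0) ∂μ ≤ εD)
    (eI : ∫⁻ z, ENNReal.ofReal (unitAvg c σ N τ fun k q =>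
        if (∃ x : T3, cellOf c σ N x = q) ∧ (nbhd c σ N (Φ.flow ((k : ℝ) * stepLen c σ N) z) q).Nonempty ∧
            (ϑ < inhom ϑs (binConfig b (Φ.flow ((k : ℝ) * stepLen c σ N) z))
                (pop c σ N (Φ.flow ((k : ℝ) * stepLen c σ N) z) q) (nbhd c σ N (Φ.flow ((k : ℝ) * stepLen c σ N) z) q) ∨
              ((pop c σ N (Φ.flow ((k : ℝ) * stepLen c σ N) z) q).Nonempty ∧
                (pop c σ N (Φ.flow ((k : ℝ) * stepLen c σ N) z) q).card < m₀)) then (1 : ℝ) else 0) ∂μ ≤ εI)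
    (hsum : εC + ENNReal.ofReal T * εD + ENNReal.ofReal T * εI ≤ ENNReal.ofReal δ) :
    unitMean c σ N τ μ (fun k q z => Jng b ϑs ϑ φs c σ N Φ k q z * min (ownedCount c σ N Φ k q z) T) ≤ δ := by
  have hh : 0 < c * meanFreePath σ N := mul_pos hc (meanFreePath_pos hσ N)
  -- the four unit-average families, as functions of the datum
  set W : Phase N → ℝ := fun z => unitAvg c σ N τ fun k q =>
    Jng b ϑs ϑ φs c σ N Φ k q z * min (ownedCount c σ N Φ k q z) T with hW
  set FC : Phase N → ℝ := fun z => unitAvg c σ N τ fun k q =>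
    (if (pop c σ N (Φ.flow ((k : ℝ) * stepLen c σ N) z) q).Nonempty ∧
        ϑ < relEnt ϑs (binConfig b (Φ.flow ((k : ℝ) * stepLen c σ N) z))
          (pop c σ N (Φ.flow ((k : ℝ) * stepLen c σ N) z) q) then (1 : ℝ) else 0) *
      min (ownedCount c σ N Φ k q z) T with hFC
  set FD : Phase N → ℝ := fun z => unitAvg c σ N τ fun k q =>
    if (pop c σ N (Φ.flow ((k : ℝ) * stepLen c σ N) z) q).Nonempty ∧
      Dense φs c σ N (Φ.flow ((k : ℝ) * stepLen c σ N) z) q then (1 : ℝ) else 0 with hFD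
  set FI : Phase N → ℝ := fun z => unitAvg c σ N τ fun k q =>
    if (∃ x : T3, cellOf c σ N x = q) ∧ (nbhd c σ N (Φ.flow ((k : ℝ) * stepLen c σ N) z) q).Nonempty ∧
        (ϑ < inhom ϑs (binConfig b (Φ.flow ((k : ℝ) * stepLen c σ N) z))
            (pop c σ N (Φ.flow ((k : ℝ) * stepLen c σ N) z) q) (nbhd c σ N (Φ.flow ((k : ℝ) * stepLen c σ N) z) q) ∨
          ((pop c σ N (Φ.flow ((k : ℝ) * stepLen c σ N) z) q).Nonempty ∧
            (pop c σ N (Φ.flow ((k : ℝ) * stepLen c σ N) z) q).card < m₀)) then (1 : ℝ) else 0 with hFI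
  -- box support and signs
  have hboxW : ∀ (z : Phase N) (k : ℕ), ∀ q ∉ cellBox (c * meanFreePath σ N),
      Jng b ϑs ϑ φs c σ N Φ k q z * min (ownedCount c σ N Φ k q z) T = 0 := fun z k q hq => by
    rw [ownedCount_eq_zero_of_not_mem hh Φ k hq z, min_eq_left hT.le, mul_zero]
  have hboxC : ∀ (z : Phase N) (k : ℕ), ∀ q ∉ cellBox (c * meanFreePath σ N),
      (if (pop c σ N (Φ.flow ((k : ℝ) * stepLen c σ N) z) q).Nonempty ∧
          ϑ < relEnt ϑs (binConfig b (Φ.flow ((k : ℝ) * stepLen c σ N) z))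
            (pop c σ N (Φ.flow ((k : ℝ) * stepLen c σ N) z) q) then (1 : ℝ) else 0) *
        min (ownedCount c σ N Φ k q z) T = 0 := fun z k q hq => by
    rw [ownedCount_eq_zero_of_not_mem hh Φ k hq z, min_eq_left hT.le, mul_zero]
  have hboxD : ∀ (z : Phase N) (k : ℕ), ∀ q ∉ cellBox (c * meanFreePath σ N),
      (if (pop c σ N (Φ.flow ((k : ℝ) * stepLen c σ N) z) q).Nonempty ∧
        Dense φs c σ N (Φ.flow ((k : ℝ) * stepLen c σ N) z) q then (1 : ℝ) else 0) = 0 :=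
    fun z k q hq => indicator_pop_eq_zero_of_not_mem hh Φ
      (fun k q z => Dense φs c σ N (Φ.flow ((k : ℝ) * stepLen c σ N) z) q) z k hq
  have hboxI : ∀ (z : Phase N) (k : ℕ), ∀ q ∉ cellBox (c * meanFreePath σ N),
      (if (∃ x : T3, cellOf c σ N x = q) ∧ (nbhd c σ N (Φ.flow ((k : ℝ) * stepLen c σ N) z) q).Nonempty ∧
          (ϑ < inhom ϑs (binConfig b (Φ.flow ((k : ℝ) * stepLen c σ N) z))
              (pop c σ N (Φ.flow ((k : ℝ) * stepLen c σ N) z) q) (nbhd c σ N (Φ.flow ((k : ℝ) * stepLen c σ N) z) q) ∨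
            ((pop c σ N (Φ.flow ((k : ℝ) * stepLen c σ N) z) q).Nonempty ∧
              (pop c σ N (Φ.flow ((k : ℝ) * stepLen c σ N) z) q).card < m₀)) then (1 : ℝ) else 0) = 0 := by
    intro z k q hq
    rw [if_neg]
    rintro ⟨⟨x, hx⟩, -⟩
    exact hq (hx ▸ cellOf_mem_cellBox hh x)
  have hW0 : ∀ z, 0 ≤ W z := fun z => unitAvg_nonneg hh.le (hboxW z) fun k q =>
    mul_nonneg (Jng_mem_Icc b ϑs ϑ φs c σ N Φ k q z).1 (le_min (ownedCount_nonneg hc.le hσ Φ k q z) hT.le)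
  have hC0 : ∀ z, 0 ≤ FC z := fun z => unitAvg_nonneg hh.le (hboxC z) fun k q =>
    weighted_nonneg (ownedCount_nonneg hc.le hσ Φ k q z) hT.le
  have hD0 : ∀ z, 0 ≤ FD z := fun z => unitAvg_nonneg hh.le (hboxD z) fun k q => by positivity
  have hI0 : ∀ z, 0 ≤ FI z := fun z => unitAvg_nonneg hh.le (hboxI z) fun k q => by positivity
  -- measurability of the packed and the irregular families
  have hmD : Measurable FD := by
    refine measurable_unitAvg_indicator τ (fun k q z =>
      (pop c σ N (Φ.flow ((k : ℝ) * stepLen c σ N) z) q).Nonempty ∧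
        Dense φs c σ N (Φ.flow ((k : ℝ) * stepLen c σ N) z) q) (fun k q => ?_) hboxD
    exact ((measurableSet_pop_nonempty c σ q).preimage (Φ.measurable_flow _)).inter
      ((measurableSet_dense φs c σ q).preimage (Φ.measurable_flow _))
  have hmI : Measurable FI := by
    refine measurable_unitAvg_indicator τ (fun k q z =>
      (∃ x : T3, cellOf c σ N x = q) ∧ (nbhd c σ N (Φ.flow ((k : ℝ) * stepLen c σ N) z) q).Nonempty ∧
        (ϑ < inhom ϑs (binConfig b (Φ.flow ((k : ℝ) * stepLen c σ N) z))
            (pop c σ N (Φ.flow ((k : ℝ) * stepLen c σ N) z) q) (nbhd c σ N (Φ.flow ((k : ℝ) * stepLen c σ N) z) q) ∨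
          ((pop c σ N (Φ.flow ((k : ℝ) * stepLen c σ N) z) q).Nonempty ∧
            (pop c σ N (Φ.flow ((k : ℝ) * stepLen c σ N) z) q).card < m₀))) (fun k q => ?_) hboxI
    exact ngrW_measurableSet_irregularB Φ b ϑs ϑ c _ m₀ q
  -- integrate the split in the `∫⁻ ofReal` currency
  have hlin : ∫⁻ z, ENNReal.ofReal (W z) ∂μ ≤ ENNReal.ofReal δ :=
    calc ∫⁻ z, ENNReal.ofReal (W z) ∂μ
        ≤ ∫⁻ z, ENNReal.ofReal (FC z) + ENNReal.ofReal T * ENNReal.ofReal (FD z) +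
            ENNReal.ofReal T * ENNReal.ofReal (FI z) ∂μ := by
          refine lintegral_mono_ae ?_
          filter_upwards [ae_mem_good_of_ac Φ hμ] with z hz
          rw [← ENNReal.ofReal_mul hT.le, ← ENNReal.ofReal_mul hT.le,
            ← ENNReal.ofReal_add (hC0 z) (mul_nonneg hT.le (hD0 z)),
            ← ENNReal.ofReal_add (add_nonneg (hC0 z) (mul_nonneg hT.le (hD0 z))) (mul_nonneg hT.le (hI0 z))]
          exact ENNReal.ofReal_le_ofReal (ngrW_unitAvg_split hJ Φ hc hσ τ b ϑs ϑ φs hT.le m₀ hz)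
      _ = (∫⁻ z, ENNReal.ofReal (FC z) ∂μ) + ENNReal.ofReal T * (∫⁻ z, ENNReal.ofReal (FD z) ∂μ) +
            ENNReal.ofReal T * ∫⁻ z, ENNReal.ofReal (FI z) ∂μ := by
          rw [lintegral_add_right _ (hmI.ennreal_ofReal.const_mul (ENNReal.ofReal T)),
            lintegral_add_right _ (hmD.ennreal_ofReal.const_mul (ENNReal.ofReal T)),
            lintegral_const_mul _ hmD.ennreal_ofReal, lintegral_const_mul _ hmI.ennreal_ofReal]
      _ ≤ εC + ENNReal.ofReal T * εD + ENNReal.ofReal T * εI :=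
          add_le_add (add_le_add eC (mul_le_mul_right eD _)) (mul_le_mul_right eI _)
      _ ≤ ENNReal.ofReal δ := hsum
  -- from the lintegral to the Bochner mean
  show ∫ z, W z ∂μ ≤ δ
  by_cases hWi : Integrable W μ
  · exact (ENNReal.ofReal_le_ofReal_iff hδ).1
      ((ofReal_integral_eq_lintegral_ofReal hWi (ae_of_all μ hW0)).trans_le hlin)
  · rw [integral_undef hWi]
    exact hδ

/-! ## H3_W from `JngSpec` and the three LG-side regularity inputs -/

/-- **`JngSpec → CoarseLocalMaxwellianityW → LocalCountUI → NoKineticIrregularityB → NonGoodRareW`** (H3_W of the weighted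
architecture `kineticCellChaosLG_of_w`, discharged): `σ₀ := min (σ_CLMW, σ_UI(φs), σ_NKIB)`; given `(σ, Φ, τ, ϑs, ϑ, δ₃, T)` the
three inputs at tolerances `δ₃/3` (weighted Maxwellianity, level `T`), `δ₃/(3T)` (`LocalCountUI` (ii)) and `δ₃/(3T)`
(`NoKineticIrregularityB`, floor `m₀ := 0`); `c₀ := max`, `b₀ := min` of the two bin-width thresholds, `N₀ := max`; then the
fixed-`N` assembly `ngrW_unitMean_le` under `LG ≪ liouville` with `ofReal (δ₃/3) + ofReal T · ofReal (δ₃/(3T)) + ofReal T ·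
ofReal (δ₃/(3T)) = ofReal δ₃`. [folklore] -/
theorem nonGoodRareW_of : JngSpec → CoarseLocalMaxwellianityW → LocalCountUI → NoKineticIrregularityB → NonGoodRareW := by
  intro hJ hclm hui hnki φs hφs a₀ θ₀ u₀ ha hθ hu ha0 hθ0
  obtain ⟨σ₁, hσ₁, H1⟩ := hclm a₀ θ₀ u₀ ha hθ hu ha0 hθ0
  obtain ⟨σ₂, hσ₂, H2⟩ := hui φs hφs a₀ θ₀ u₀ ha hθ hu ha0 hθ0
  obtain ⟨σ₃, hσ₃, H3⟩ := hnki a₀ θ₀ u₀ ha hθ hu ha0 hθ0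
  refine ⟨min σ₁ (min σ₂ σ₃), by positivity, ?_⟩
  intro σ hσ hσlt Φ τ hτ ϑs ϑ δ₃ T hϑs hϑ hδ₃ hT
  have hσ₁' : σ < σ₁ := hσlt.trans_le (min_le_left _ _)
  have hσ₂' : σ < σ₂ := hσlt.trans_le ((min_le_right _ _).trans (min_le_left _ _))
  have hσ₃' : σ < σ₃ := hσlt.trans_le ((min_le_right _ _).trans (min_le_right _ _))
  have hδ' : 0 < δ₃ / 3 := by positivity
  have hδT : 0 < δ₃ / (3 * T) := by positivity
  -- the thresholds of the three inputs
  obtain ⟨c₁, hc₁, H1c⟩ := H1 σ hσ hσ₁' Φ τ hτ ϑs ϑ (δ₃ / 3) T hϑs hϑ hδ' hT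
  obtain ⟨c₂, hc₂, H2c⟩ := (H2 σ hσ hσ₂' Φ τ hτ (δ₃ / (3 * T)) hδT).2
  obtain ⟨c₃, hc₃, H3c⟩ := H3 σ hσ hσ₃' Φ τ hτ ϑs ϑ (δ₃ / (3 * T)) 0 hϑs hϑ hδT
  refine ⟨max c₁ (max c₂ c₃), lt_max_of_lt_left hc₁, fun c hc => ?_⟩
  have hc₁' : c₁ ≤ c := (le_max_left _ _).trans hc
  have hc₂' : c₂ ≤ c := ((le_max_left _ _).trans (le_max_right _ _)).trans hc
  have hc₃' : c₃ ≤ c := ((le_max_right _ _).trans (le_max_right _ _)).trans hc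
  have hc0 : 0 < c := hc₁.trans_le hc₁'
  obtain ⟨b₁, hb₁, H1b⟩ := H1c c hc₁'
  obtain ⟨N₂, H2N⟩ := H2c c hc₂'
  obtain ⟨b₃, hb₃, H3b⟩ := H3c c hc₃'
  refine ⟨min b₁ b₃, lt_min hb₁ hb₃, fun b hb hbb => ?_⟩
  obtain ⟨N₁, H1N⟩ := H1b b hb (hbb.trans (min_le_left _ _))
  obtain ⟨N₃, H3N⟩ := H3b b hb (hbb.trans (min_le_right _ _))
  refine ⟨max N₁ (max N₂ N₃), fun N hN => ?_⟩
  have hN₁ : N₁ ≤ N := (le_max_left _ _).trans hN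
  have hN₂ : N₂ ≤ N := ((le_max_left _ _).trans (le_max_right _ _)).trans hN
  have hN₃ : N₃ ≤ N := ((le_max_right _ _).trans (le_max_right _ _)).trans hN
  -- the tolerances add up to `δ₃`
  have hTd : ENNReal.ofReal T * ENNReal.ofReal (δ₃ / (3 * T)) = ENNReal.ofReal (δ₃ / 3) := by
    rw [← ENNReal.ofReal_mul hT.le]
    congr 1
    field_simp
  have hsum : ENNReal.ofReal (δ₃ / 3) + ENNReal.ofReal T * ENNReal.ofReal (δ₃ / (3 * T)) +
      ENNReal.ofReal T * ENNReal.ofReal (δ₃ / (3 * T)) ≤ ENNReal.ofReal δ₃ := by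
    rw [hTd, ← ENNReal.ofReal_add hδ'.le hδ'.le, ← ENNReal.ofReal_add (add_nonneg hδ'.le hδ'.le) hδ'.le]
    refine ENNReal.ofReal_le_ofReal (le_of_eq ?_)
    ring
  exact ngrW_unitMean_le hJ (Φ N) (localGibbsLaw σ a₀ u₀ θ₀ N (Φ N))
    (localGibbsLaw_absolutelyContinuous_liouville σ a₀ u₀ θ₀ N (Φ N)) hσ hc0 τ b ϑs ϑ φs hT hδ₃.le 0
    (H1N N hN₁) (H2N N hN₂) (H3N N hN₃) hsum

end Summit.AtomisticToContinuum.HydrodynamicLimit.Theorems.EquilibriumForecastLine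

end
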